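import Literature.NumberTheory.Automorphic.ArchInnerFormChartOrbitalSmooth     -- ★ p850500∕p850509 (F0P3a-p05 (g20)): `cexp_add_mul_I_sub_cexp_mul_I_ne_zero`, `contDiffOn_archRG_regG` (the `RegG` case); brings ★ `archRG`, ★ (COORD)
import HarnessLib

/-!
# Shelstad's normaliser `archRG S′` is `C^∞` OFF THE SPLIT-PLACE ZERO SET `{c | ∀ w ∈ S′, x_w ≠ 0}` — in particular ACROSS THE COMPACT WALLS of the compact-chart places
# (Shelstad 1979 §4 p. 22; Rogawski 1990 §8.2; Bouaziz 1994 §3.2)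

Topic `NumberTheory/Automorphic`; namespace `Literature.NumberTheory.Automorphic.ArchCartan`.  THEOREMS ONLY (no `def`, no instance, no notation, no axiom, no named fact, no `sorry`).
Cell `pub/hodgecm-mathlib`, crux H413 (`stmt-HodgeConjecture-24833`), F0∕P3c line LH3 (closer stub `stub_N9`, N9″ DIRECT ROAD), letter L1 `HcOrbitalFamiliesStatement` pay-down
**(I₂-InRegG-cpt-G′)** (LH3-plan (g3) 2026-09-02T08:22:51Z → F0P3b-p01 (g15)), sub-brick (ARCHRG-off-zero): ★ `contDiffOn_archRG_regG` (F0P3a-p05 (g20)) proves smoothness of `R′_{S′}`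
on `RegG S′`, but its proof only uses the SPLIT-place condition `x_w ≠ 0` (`w ∈ S′`) — the compact-place factors `(1 − e^{i(θ₁−θ₀)})(1 − e^{i(θ₂−θ₀)})(1 − e^{i(θ₂−θ₁)})` are
ENTIRE in the angles.  So `R′_{S′}` is `C^∞` on the larger open set `{c | ∀ w ∈ S′, c w 0 ≠ 0}`, which contains `RegG S′` AND every compact-wall point of every compact-chart place
(`θ_i = θ_j`, `w ∉ S′`) — the normaliser is no obstruction to smoothness of `orbFamG = R′ · chartOrbG` across compact walls.

* `isOpen_setOf_forall_mem_apply_ne_zero` (the set is open), `regG_subset_setOf_split_ne_zero`, **`contDiffOn_archRG_of_split_ne_zero (S′) : ContDiffOn ℝ ∞ (archRG S′) {c | ∀ w ∈ S′, c w 0 ≠ 0}`**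
  (proof = ★ `contDiffOn_archRG_regG`'s, verbatim, with the `RegG` membership replaced by the split condition).
HONEST LABEL: HC_CM is proved only modulo the 7 printed citations (2 remaining: hLiu418 = `stmt-HodgeConjecture-24832`, h413 = `stmt-HodgeConjecture-24833`) until rung 0 closes;
count-neutral kit, pays nothing by itself.

## References
* [Shelstad1979] D. Shelstad, *Characters and inner forms of a quasi-split group over ℝ*, Compositio Math. 39 (1979) 11–45, §4 p. 22 (`R_T`).
* [Rogawski1990] J. D. Rogawski, *Automorphic Representations of Unitary Groups in Three Variables*, Ann. of Math. Stud. 123 (1990), §8.2 p. 118.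
* [Bouaziz1994IntegralesOrbitales] A. Bouaziz, *Intégrales orbitales sur les groupes de Lie réductifs*, Ann. Sci. ÉNS 27 (1994), §3.2 p. 580.
-/

set_option autoImplicit false

noncomputable section

open Complex Set Function Real Filter Topology
open scoped ContDiff

namespace Literature.NumberTheory.Automorphic.ArchCartan

section Coord

variable {W : Type*} [Fintype W] [DecidableEq W]

omit [Fintype W] [DecidableEq W] in
/-- The split-place non-degeneracy set `{c | ∀ w ∈ S′, c w 0 ≠ 0}` is open (finite intersection of preimages of `{0}ᶜ` under coordinate evaluations). [cite: Shelstad1979, §4 p. 22] -/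
theorem isOpen_setOf_forall_mem_apply_ne_zero (S' : Finset W) : IsOpen {c : W → Fin 3 → ℝ | ∀ w ∈ S', c w 0 ≠ 0} := by
  have h : {c : W → Fin 3 → ℝ | ∀ w ∈ S', c w 0 ≠ 0} = ⋂ w ∈ S', {c : W → Fin 3 → ℝ | c w 0 ≠ 0} := by
    ext c; simp
  rw [h]
  refine isOpen_biInter_finset fun w _ => ?_
  exact isOpen_ne_fun ((continuous_apply 0).comp (continuous_apply w)) continuous_const

omit [Fintype W] [DecidableEq W] in
/-- `RegG S′ ⊆ {c | ∀ w ∈ S′, c w 0 ≠ 0}`. [cite: Shelstad1979, §4 p. 22] -/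
theorem regG_subset_setOf_split_ne_zero (S' : Finset W) : RegG S' ⊆ {c : W → Fin 3 → ℝ | ∀ w ∈ S', c w 0 ≠ 0} :=
  fun c hc w hw => ((mem_regG_iff S' c).1 hc).2 w hw

/-- **`archRG S′` is `C^∞` off the split-place zero set** — across every compact wall of the compact-chart places (the compact-place factors are entire; the split-place factors
`|e^x − e^{−x}|·|e^{x+iθ}−e^{iφ}|·|e^{−x+iθ}−e^{iφ}|` are smooth where `x ≠ 0`).  Proof = ★ `contDiffOn_archRG_regG`'s (F0P3a-p05 (g20)) with `RegG` membership weakened to the split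
condition. [cite: Shelstad1979, §4 p. 22] [cite: Rogawski1990, §8.2 p. 118] [cite: Bouaziz1994IntegralesOrbitales, §3.2 p. 580] -/
theorem contDiffOn_archRG_of_split_ne_zero (S' : Finset W) : ContDiffOn ℝ ∞ (archRG S') {c : W → Fin 3 → ℝ | ∀ w ∈ S', c w 0 ≠ 0} := by
  unfold archRG
  refine contDiffOn_prod fun w _ => ?_
  by_cases hw : w ∈ S'
  · simp only [if_pos hw]
    intro c hc
    have hx : c w 0 ≠ 0 := hc w hw
    have hne : Real.exp (c w 0) - Real.exp (-c w 0) ≠ 0 := by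
      intro h0
      have h' : c w 0 = -c w 0 := Real.exp_injective (sub_eq_zero.1 h0)
      exact hx (by linarith)
    have h0 : ContDiff ℝ ∞ fun c : W → Fin 3 → ℝ => c w 0 := contDiff_apply_apply ℝ ℝ w 0
    have h1 : ContDiff ℝ ∞ fun c : W → Fin 3 → ℝ => c w 1 := contDiff_apply_apply ℝ ℝ w 1
    have h2 : ContDiff ℝ ∞ fun c : W → Fin 3 → ℝ => c w 2 := contDiff_apply_apply ℝ ℝ w 2
    have hg : ContDiff ℝ ∞ fun c : W → Fin 3 → ℝ => Real.exp (c w 0) - Real.exp (-c w 0) :=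
      (Real.contDiff_exp.comp h0).sub (Real.contDiff_exp.comp h0.neg)
    have hz₁ : ContDiff ℝ ∞ fun c : W → Fin 3 → ℝ => Complex.exp ((c w 0 : ℂ) + (c w 2 : ℂ) * I) - Complex.exp ((c w 1 : ℂ) * I) :=
      (Complex.contDiff_exp.comp ((ofRealCLM.contDiff.comp h0).add ((ofRealCLM.contDiff.comp h2).mul contDiff_const))).sub
        (Complex.contDiff_exp.comp ((ofRealCLM.contDiff.comp h1).mul contDiff_const))
    have hz₂ : ContDiff ℝ ∞ fun c : W → Fin 3 → ℝ => Complex.exp (-(c w 0 : ℂ) + (c w 2 : ℂ) * I) - Complex.exp ((c w 1 : ℂ) * I) :=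
      (Complex.contDiff_exp.comp ((ofRealCLM.contDiff.comp h0).neg.add ((ofRealCLM.contDiff.comp h2).mul contDiff_const))).sub
        (Complex.contDiff_exp.comp ((ofRealCLM.contDiff.comp h1).mul contDiff_const))
    have hne₁ : Complex.exp ((c w 0 : ℂ) + (c w 2 : ℂ) * I) - Complex.exp ((c w 1 : ℂ) * I) ≠ 0 :=
      cexp_add_mul_I_sub_cexp_mul_I_ne_zero hx _ _
    have hne₂ : Complex.exp (-(c w 0 : ℂ) + (c w 2 : ℂ) * I) - Complex.exp ((c w 1 : ℂ) * I) ≠ 0 := by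
      have h := cexp_add_mul_I_sub_cexp_mul_I_ne_zero (neg_ne_zero.2 hx) (c w 2) (c w 1)
      simpa using h
    have hA : ContDiffAt ℝ ∞ (fun c : W → Fin 3 → ℝ => |Real.exp (c w 0) - Real.exp (-c w 0)|) c := hg.contDiffAt.abs hne
    have hB : ContDiffAt ℝ ∞ (fun c : W → Fin 3 → ℝ => ‖Complex.exp ((c w 0 : ℂ) + (c w 2 : ℂ) * I) - Complex.exp ((c w 1 : ℂ) * I)‖) c :=
      hz₁.contDiffAt.norm ℝ hne₁
    have hC : ContDiffAt ℝ ∞ (fun c : W → Fin 3 → ℝ => ‖Complex.exp (-(c w 0 : ℂ) + (c w 2 : ℂ) * I) - Complex.exp ((c w 1 : ℂ) * I)‖) c :=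
      hz₂.contDiffAt.norm ℝ hne₂
    exact (ofRealCLM.contDiff.contDiffAt.comp c ((hA.mul hB).mul hC)).contDiffWithinAt
  · simp only [if_neg hw]
    have he : ∀ i j : Fin 3, ContDiff ℝ ∞ fun c : W → Fin 3 → ℝ => (Circle.exp (c w j - c w i) : ℂ) := by
      intro i j
      have h : (fun c : W → Fin 3 → ℝ => (Circle.exp (c w j - c w i) : ℂ)) = fun c => Complex.exp (((c w j - c w i : ℝ) : ℂ) * I) :=
        funext fun c => Circle.coe_exp _
      rw [h]
      exact Complex.contDiff_exp.comp
        ((ofRealCLM.contDiff.comp ((contDiff_apply_apply ℝ ℝ w j).sub (contDiff_apply_apply ℝ ℝ w i))).mul contDiff_const)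
    exact (((contDiff_const.sub (he 0 1)).mul (contDiff_const.sub (he 0 2))).mul (contDiff_const.sub (he 1 2))).contDiffOn

end Coord

end Literature.NumberTheory.Automorphic.ArchCartan

end
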